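import Literature.NumberTheory.EllipticCurves.ModPCongruenceIsomorphismProofs
import Literature.NumberTheory.EllipticCurves.TorsionFrobeniusProofs
import Literature.NumberTheory.GaloisRepresentations.ResidualRepOfCongruentFrobenius
import Literature.RepresentationTheory.Semisimple.IrreducibleOfCharpoly
import Literature.RepresentationTheory.Semisimple.FinTwoSemisimplification
import HarnessLib

/-!
# Route `KatoDescentTamePotSupersingular` (rung K8-t′, cell `bsd-potss`), open core `TameLowerIntrinsicNonCM`
# (item stmt-BirchSwinnertonDyer-19618) — the RESIDUAL IDENTIFICATION behind the Fouquet-2024 fibre roads, file I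
# (BRICKS): conjugation from an equivalence, lifting through the residue map, irreducibility from transvections,
# and the mod-`p` representation of an elliptic curve FRAMED in an `𝔽_p`-basis
# (a `--supports … --as helper` file; seat `bsd-potss-k8t-c2` generation 18; ROUTE-FREE, NO definitions)

PARTITION (D-0054, cell bsd-potss): EXCLUDED-DOMAIN non-CM additive `p` · B4 (t′) (`e ∈ {3,4,6}`; cell
`(5; II*, v₅(c₄) = 4)` for the fibre roads), `r_an = 0`, LOWER half L₀ — proves-over-readings (the last named-print
input, part (a) of the desk's (C1) reading «`ρ̄_Δ ≅ ρ̄_W ⊗ k` from congruence of `a_ℓ` + `Surj W p` — Deligne +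
Chebotarev + Brauer–Nesbitt», behind the cite-level facts
`Fouquet2024.padicValRat_bsd_rank_zero_of_ordinaryFibre{,_ellipticShape}_levelNotOneModP` (p525876) consumed by
skeleton v7's `FibreRowB` / `FibreRowA`, and behind seat g17's file XXII `…AdjointBricksFiveCoeffField.lean`
(p568821 + p569741), whose ONE displayed binder `hres` — «some `P₀ ∈ GL₂(𝒪)` conjugates `Δ.ρ` to a representation
whose reduction covers `GL₂(𝔽₅)`» — file II proves from Frobenius data); closes NONE; shrinks-literal none; books
nothing; BSD is claimed for no curve.

CONTENT (all PROVED, route-free, no definition, no named fact):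
* §1 `exists_conj_of_equiv_glRepresentation` — an equivalence (Mathlib `Representation.Equiv`) of the column-vector
  representations of `τ, τ' : G → GL_n(k)` is a conjugation `τ' = Q τ Q⁻¹`; `exists_generalLinearGroup_map_residue_eq`
  — `GL_n(S) → GL_n(S/𝔪)` is onto for a local ring `S`; `generalLinearGroup_map_eq_iff` (entrywise reading);
  `isIrreducible_of_transvections_mem_range` — a homomorphism `G → GL₂(k)` whose image contains `(1 1; 0 1)` and
  `(1 0; 1 1)` acts irreducibly on `k²`; `residue_eq_residue_iff`.
* §2 the mod-`p` representation `ρ̄_{W,p}` of an elliptic curve `W/ℚ` (the tree's `WeierstrassCurve.galoisRepTorsionLin`)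
  FRAMED in an `𝔽_p`-basis `b` of `W[p]`: a homomorphism `φ : Γ_ℚ → GL₂(𝔽_p)` with matrices `toMatrix b b (ρ̄ σ)`
  EXISTS (`exists_framed_galoisRepTorsionLin`; an existence statement, so that no definition is introduced); if
  `ρ̄_{W,p}` is onto (`HasSurjectiveModNGaloisRep`) then `φ` is onto `GL₂(𝔽_p)`
  (`exists_apply_eq_of_hasSurjectiveModNGaloisRep`); `φ` is trivial on the open pointwise stabiliser of `W[p]`
  (`exists_isOpen_subgroup_le_ker_framed`, the tree's `isOpen_stabilizer_point_holds`); at an arithmetic Frobenius above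
  a good prime `ℓ ≠ p` its characteristic polynomial is `X² − a_ℓ(W) X + ℓ` (`charpoly_framed_frobenius_eq`, the tree's
  `trace_galoisRepTorsion_frobenius_eq` (Serre 1981 (238)) and `det_galoisRepTorsion_frobenius_eq` (DDT Prop. 2.8 (a))).

HONEST LABEL.  Linear algebra and the Galois theory of `W[p]` over tree theorems; nothing about items 19618/19981
(open: Kato's Conj. 12.10 lower inclusion at an additive potentially supersingular prime), which stay OPEN.  No
definition, no named fact, no `sorry`; axioms `propext`, `Classical.choice`, `Quot.sound`.

References: [DarmonDiamondTaylor1995] §2.2, Prop. 2.6 (b), Prop. 2.8 (a), Prop. 2.11 (a) (PDF pp. 53–57);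
[Serre1972] §4; [Serre1981] §8.1 (238); [SilvermanAEC2009] III.§7, Cor. III.6.4; [BourbakiAlgebreVIII2012] VIII §20 n°6.
-/

set_option autoImplicit false
-- sibling precedent (the `…FibreAdjointBricksFive*` family): the directory name repeats the summit name
set_option linter.dupNamespace false

noncomputable section

open scoped MatrixGroups NumberField Polynomial
open Matrix IsLocalRing Field IsDedekindDomain NumberField Polynomial WeierstrassCurve
open Literature.NumberTheory.GaloisRepresentations Literature.NumberTheory.EllipticCurves
  Literature.RepresentationTheory.Semisimple


namespace Summit.BirchSwinnertonDyer.BirchSwinnertonDyer.Theorems.FibreResidualIdentification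

universe u v

/-! ## §1 Linear algebra: conjugation from an equivalence, lifting through the residue map, irreducibility
from transvections -/

section LinearAlgebra

variable {G : Type u} [Group G] {k : Type v} [Field k] {n : ℕ}

/-- **An equivalence of the column-vector representations of `τ, τ' : G → GL_n(k)` is a conjugation**:
`τ' g = Q τ g Q⁻¹` for the matrix `Q` of the equivalence. [folklore] -/
theorem exists_conj_of_equiv_glRepresentation (τ τ' : G →* GL (Fin n) k)
    (e : (glRepresentation τ).Equiv (glRepresentation τ')) :
    ∃ Q : GL (Fin n) k, ∀ g, τ' g = Q * τ g * Q⁻¹ := by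
  classical
  let E : (Fin n → k) ≃ₗ[k] (Fin n → k) := e.toLinearEquiv
  have hEE : E.toLinearMap ∘ₗ E.symm.toLinearMap = LinearMap.id :=
    LinearMap.ext fun v ↦ E.apply_symm_apply v
  have hEE' : E.symm.toLinearMap ∘ₗ E.toLinearMap = LinearMap.id :=
    LinearMap.ext fun v ↦ E.symm_apply_apply v
  let Q : GL (Fin n) k :=
    ⟨LinearMap.toMatrix' E.toLinearMap, LinearMap.toMatrix' E.symm.toLinearMap,
      by rw [← LinearMap.toMatrix'_comp, hEE, LinearMap.toMatrix'_id],
      by rw [← LinearMap.toMatrix'_comp, hEE', LinearMap.toMatrix'_id]⟩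
  refine ⟨Q, fun g ↦ ?_⟩
  -- the intertwining relation `E ∘ τ g = τ' g ∘ E` in matrices
  have hτ : (glRepresentation τ g : (Fin n → k) →ₗ[k] (Fin n → k)) =
      Matrix.toLin' ((τ g : GL (Fin n) k) : Matrix (Fin n) (Fin n) k) :=
    LinearMap.ext fun w ↦ by rw [Matrix.toLin'_apply]; rfl
  have hτ' : (glRepresentation τ' g : (Fin n → k) →ₗ[k] (Fin n → k)) =
      Matrix.toLin' ((τ' g : GL (Fin n) k) : Matrix (Fin n) (Fin n) k) :=
    LinearMap.ext fun w ↦ by rw [Matrix.toLin'_apply]; rfl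
  have hint : E.toLinearMap ∘ₗ (glRepresentation τ g) = (glRepresentation τ' g) ∘ₗ E.toLinearMap :=
    e.isIntertwining' g
  rw [hτ, hτ'] at hint
  have hmat : LinearMap.toMatrix' E.toLinearMap * ((τ g : GL (Fin n) k) : Matrix (Fin n) (Fin n) k) =
      ((τ' g : GL (Fin n) k) : Matrix (Fin n) (Fin n) k) * LinearMap.toMatrix' E.toLinearMap := by
    have := congrArg LinearMap.toMatrix' hint
    rwa [LinearMap.toMatrix'_comp, LinearMap.toMatrix'_comp, LinearMap.toMatrix'_toLin',
      LinearMap.toMatrix'_toLin'] at this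
  -- `τ' g = Q τ g Q⁻¹`
  have hQ : (Q : Matrix (Fin n) (Fin n) k) = LinearMap.toMatrix' E.toLinearMap := rfl
  rw [eq_mul_inv_iff_mul_eq]
  refine Units.ext ?_
  rw [Units.val_mul, Units.val_mul, hQ]
  exact hmat.symm

variable {S : Type u} [CommRing S] [IsLocalRing S]

/-- **`GL_n(S) → GL_n(S/𝔪)` is onto for a local ring `S`**: lift the entries; the determinant of the lift reduces to
a unit, so it is a unit. [folklore] -/
theorem exists_generalLinearGroup_map_residue_eq (Q : GL (Fin n) (ResidueField S)) :
    ∃ P : GL (Fin n) S, Matrix.GeneralLinearGroup.map (residue S) P = Q := by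
  classical
  choose f hf using residue_surjective (R := S)
  let M : Matrix (Fin n) (Fin n) S := fun i j ↦ f ((Q : Matrix (Fin n) (Fin n) (ResidueField S)) i j)
  have hM : M.map (residue S) = (Q : Matrix (Fin n) (Fin n) (ResidueField S)) := by
    ext i j
    exact hf _
  have hdet : IsUnit M.det := by
    rw [← residue_ne_zero_iff_isUnit, RingHom.map_det, RingHom.mapMatrix_apply, hM]
    exact (Matrix.isUnits_det_units Q).ne_zero
  obtain ⟨P, hP⟩ := (Matrix.isUnit_iff_isUnit_det M).mpr hdet
  refine ⟨P, Units.ext ?_⟩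
  change ((P : Matrix (Fin n) (Fin n) S)).map (residue S) = _
  rw [hP, hM]

omit [IsLocalRing S] in
/-- Entrywise reading of `GL_n(f) P = Q`. [folklore] -/
theorem generalLinearGroup_map_eq_iff {T : Type v} [CommRing T] (f : S →+* T) (P : GL (Fin n) S)
    (Q : GL (Fin n) T) :
    Matrix.GeneralLinearGroup.map f P = Q ↔ ∀ i j, f (P.val i j) = Q.val i j := by
  constructor
  · intro h i j
    have := congrArg (fun R : GL (Fin n) T ↦ R.val i j) h
    simpa [Matrix.GeneralLinearGroup.map] using this
  · intro h
    refine Units.ext (Matrix.ext fun i j ↦ ?_)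
    simpa [Matrix.GeneralLinearGroup.map] using h i j

/-- **A homomorphism `G → GL₂(k)` whose image contains the two elementary transvections acts irreducibly
on `k²`**: a stable line `k·v` is killed coordinate by coordinate. [folklore] -/
theorem isIrreducible_of_transvections_mem_range (τ : G →* GL (Fin 2) k)
    (h12 : ∃ g, ((τ g : GL (Fin 2) k) : Matrix (Fin 2) (Fin 2) k) = !![1, 1; 0, 1])
    (h21 : ∃ g, ((τ g : GL (Fin 2) k) : Matrix (Fin 2) (Fin 2) k) = !![1, 0; 1, 1]) :
    (glRepresentation τ).IsIrreducible := by
  classical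
  obtain ⟨g₁, hg₁⟩ := h12
  obtain ⟨g₂, hg₂⟩ := h21
  have hbt : (⊥ : Subrepresentation (glRepresentation τ)) ≠ ⊤ := by
    intro h
    have h' : (⊥ : Submodule k (Fin 2 → k)) = ⊤ := congrArg Subrepresentation.toSubmodule h
    exact bot_ne_top h'
  refine { toNontrivial := ⟨⟨⊥, ⊤, hbt⟩⟩, eq_bot_or_eq_top := fun U ↦ ?_ }
  by_contra hU
  push Not at hU
  obtain ⟨hU0, hU1⟩ := hU
  have hU0' : U.toSubmodule ≠ ⊥ := fun h ↦ hU0 (Subrepresentation.toSubmodule_injective h)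
  have hU1' : U.toSubmodule ≠ ⊤ := fun h ↦ hU1 (Subrepresentation.toSubmodule_injective h)
  -- a non-zero vector of the proper stable subspace `U`
  obtain ⟨v, hvU, hv0⟩ := (Submodule.ne_bot_iff U.toSubmodule).mp hU0'
  have hdim : Module.finrank k U.toSubmodule = 1 := finrank_eq_one_of_ne_bot_of_ne_top hU0' hU1'
  -- `U = k·v`
  have hspan : U.toSubmodule = k ∙ v := by
    have hle : (k ∙ v) ≤ U.toSubmodule := (Submodule.span_singleton_le_iff_mem v _).mpr hvU
    haveI : FiniteDimensional k U.toSubmodule := Module.finite_of_finrank_eq_succ hdim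
    refine (Submodule.eq_of_le_of_finrank_eq hle ?_).symm
    rw [hdim, finrank_span_singleton hv0]
  -- stability under the two transvections
  have hstab : ∀ g, glRepresentation τ g v ∈ U.toSubmodule := fun g ↦ U.apply_mem_toSubmodule g hvU
  have h1 := hstab g₁
  have h2 := hstab g₂
  rw [hspan, Submodule.mem_span_singleton] at h1 h2
  obtain ⟨c₁, hc₁⟩ := h1
  obtain ⟨c₂, hc₂⟩ := h2
  have e1 : glRepresentation τ g₁ v = !![1, 1; 0, 1] *ᵥ v := by
    rw [glRepresentation_apply_apply, hg₁]
  have e2 : glRepresentation τ g₂ v = !![1, 0; 1, 1] *ᵥ v := by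
    rw [glRepresentation_apply_apply, hg₂]
  rw [e1] at hc₁
  rw [e2] at hc₂
  have h10 : c₁ * v 0 = v 0 + v 1 := by
    have := congrFun hc₁ 0
    simpa [Matrix.mulVec, dotProduct, Fin.sum_univ_two, Matrix.vecHead, Matrix.vecTail] using this
  have h11 : c₁ * v 1 = v 1 := by
    have := congrFun hc₁ 1
    simpa [Matrix.mulVec, dotProduct, Fin.sum_univ_two, Matrix.vecHead, Matrix.vecTail] using this
  have h20 : c₂ * v 0 = v 0 := by
    have := congrFun hc₂ 0
    simpa [Matrix.mulVec, dotProduct, Fin.sum_univ_two, Matrix.vecHead, Matrix.vecTail] using this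
  have h21' : c₂ * v 1 = v 0 + v 1 := by
    have := congrFun hc₂ 1
    simpa [Matrix.mulVec, dotProduct, Fin.sum_univ_two, Matrix.vecHead, Matrix.vecTail] using this
  -- from `c₁ v₁ = v₁`, `c₁ v₀ = v₀ + v₁`, `c₂ v₀ = v₀`, `c₂ v₁ = v₀ + v₁` deduce `v = 0`
  apply hv0
  have hv1 : v 1 = 0 := by
    by_cases hc : c₁ = 1
    · rw [hc, one_mul] at h10
      linear_combination -h10
    · have : (c₁ - 1) * v 1 = 0 := by linear_combination h11
      rcases mul_eq_zero.mp this with h | h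
      · exact absurd (sub_eq_zero.mp h) hc
      · exact h
  have hv0' : v 0 = 0 := by
    by_cases hc : c₂ = 1
    · rw [hc, one_mul] at h21'
      linear_combination -h21'
    · have : (c₂ - 1) * v 0 = 0 := by linear_combination h20
      rcases mul_eq_zero.mp this with h | h
      · exact absurd (sub_eq_zero.mp h) hc
      · exact h
  ext i
  fin_cases i
  · exact hv0'
  · exact hv1

end LinearAlgebra

/-! ## §2 The mod-`p` representation of an elliptic curve, framed in an `𝔽_p`-basis of `W[p]` -/

section Framed

variable (W : WeierstrassCurve ℚ) [W.IsElliptic] (p : ℕ) [Fact p.Prime]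

omit [W.IsElliptic] in
/-- **A frame for `ρ̄_{W,p}`**: for an `𝔽_p`-basis `b` of `W[p]` there is a homomorphism
`φ : Γ_ℚ → GL₂(𝔽_p)` whose matrices are the matrices of `ρ̄_{W,p}(σ)` in the basis `b` (namely
`GL₂(toMatrix b b) ∘ ρ̄`; stated as an existence so that no definition is introduced).
[cite: SilvermanAEC2009, III.§7 (the representation on E[m])] -/
theorem exists_framed_galoisRepTorsionLin :
    letI : Module (ZMod p) (W.geomTorsion p) := AddSubgroup.torsionBy.zmodModule
    ∀ b : Module.Basis (Fin 2) (ZMod p) (W.geomTorsion p),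
    ∃ φ : absoluteGaloisGroup ℚ →* GL (Fin 2) (ZMod p), ∀ σ,
      ((φ σ : GL (Fin 2) (ZMod p)) : Matrix (Fin 2) (Fin 2) (ZMod p)) =
        LinearMap.toMatrix b b (W.galoisRepTorsionLin p σ) := by
  letI : Module (ZMod p) (W.geomTorsion p) := AddSubgroup.torsionBy.zmodModule
  intro b
  refine ⟨(Units.map (MonoidHomClass.toMonoidHom (LinearMap.toMatrixAlgEquiv b))).comp
    (W.galoisRepTorsionLin p).asGroupHom, fun σ ↦ ?_⟩
  change LinearMap.toMatrixAlgEquiv b ((W.galoisRepTorsionLin p).asGroupHom σ : _ →ₗ[ZMod p] _) = _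
  rw [Representation.asGroupHom_apply]
  rfl

variable {W p}

omit [W.IsElliptic] in
/-- **`ρ̄_{W,p}` onto ⇒ the frame is onto `GL₂(𝔽_p)`**: every `q ∈ GL₂(𝔽_p)` is the matrix of some
`ρ̄_{W,p}(γ)` (`HasSurjectiveModNGaloisRep`: every additive automorphism of `W[p]` is a `σ`).
[cite: Serre1972, §4] -/
theorem exists_apply_eq_of_hasSurjectiveModNGaloisRep (hsurj : W.HasSurjectiveModNGaloisRep p) :
    letI : Module (ZMod p) (W.geomTorsion p) := AddSubgroup.torsionBy.zmodModule
    ∀ (b : Module.Basis (Fin 2) (ZMod p) (W.geomTorsion p)) {φ : absoluteGaloisGroup ℚ →* GL (Fin 2) (ZMod p)},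
    (∀ σ, ((φ σ : GL (Fin 2) (ZMod p)) : Matrix (Fin 2) (Fin 2) (ZMod p)) =
      LinearMap.toMatrix b b (W.galoisRepTorsionLin p σ)) →
    ∀ q : GL (Fin 2) (ZMod p), ∃ γ : absoluteGaloisGroup ℚ, φ γ = q := by
  letI : Module (ZMod p) (W.geomTorsion p) := AddSubgroup.torsionBy.zmodModule
  intro b φ hφ q
  -- the additive automorphism of `W[p]` with matrix `q`
  let L : W.geomTorsion p →ₗ[ZMod p] W.geomTorsion p := Matrix.toLin b b (q : Matrix (Fin 2) (Fin 2) (ZMod p))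
  let L' : W.geomTorsion p →ₗ[ZMod p] W.geomTorsion p :=
    Matrix.toLin b b ((q⁻¹ : GL (Fin 2) (ZMod p)) : Matrix (Fin 2) (Fin 2) (ZMod p))
  have hLL' : L ∘ₗ L' = LinearMap.id := by
    change Matrix.toLin b b _ ∘ₗ Matrix.toLin b b _ = _
    rw [← Matrix.toLin_mul b b b, ← Units.val_mul, mul_inv_cancel, Units.val_one, Matrix.toLin_one]
  have hL'L : L' ∘ₗ L = LinearMap.id := by
    change Matrix.toLin b b _ ∘ₗ Matrix.toLin b b _ = _
    rw [← Matrix.toLin_mul b b b, ← Units.val_mul, inv_mul_cancel, Units.val_one, Matrix.toLin_one]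
  let e : W.geomTorsion p ≃ₗ[ZMod p] W.geomTorsion p :=
    LinearEquiv.ofLinear L L' hLL' hL'L
  obtain ⟨γ, hγ⟩ := hsurj (Multiplicative.ofAdd e.toAddEquiv)
  refine ⟨γ, Units.ext ?_⟩
  rw [hφ γ]
  have hlin : W.galoisRepTorsionLin p γ = L := by
    refine LinearMap.ext fun P ↦ ?_
    rw [galoisRepTorsionLin_apply]
    have h1 : (W.galoisRepTorsion p γ).toAdd P = γ • P := WeierstrassCurve.galoisRepTorsion_apply W p γ P
    rw [← h1, hγ]
    rfl
  rw [hlin]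
  exact LinearMap.toMatrix_toLin b b _

/-- **The frame is trivial on the pointwise stabiliser of `W[p]`, an open subgroup of `Γ_ℚ`** (so its
kernel is open: `Γ_ℚ` acts on `W[p]` through the finite quotient `Gal(ℚ(W[p])/ℚ)`). [cite: Serre1972, §4] -/
theorem exists_isOpen_subgroup_le_ker_framed :
    letI : Module (ZMod p) (W.geomTorsion p) := AddSubgroup.torsionBy.zmodModule
    ∀ (b : Module.Basis (Fin 2) (ZMod p) (W.geomTorsion p)) {φ : absoluteGaloisGroup ℚ →* GL (Fin 2) (ZMod p)},
    (∀ σ, ((φ σ : GL (Fin 2) (ZMod p)) : Matrix (Fin 2) (Fin 2) (ZMod p)) =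
      LinearMap.toMatrix b b (W.galoisRepTorsionLin p σ)) →
    ∃ K : Subgroup (absoluteGaloisGroup ℚ), IsOpen (K : Set (absoluteGaloisGroup ℚ)) ∧ ∀ κ ∈ K, φ κ = 1 := by
  letI : Module (ZMod p) (W.geomTorsion p) := AddSubgroup.torsionBy.zmodModule
  intro b φ hφ
  have hp : p.Prime := Fact.out
  haveI : Finite (W.geomTorsion p) :=
    finite_torsionPoints_holds W (AlgebraicClosure ℚ) (n := p) (by exact_mod_cast hp.ne_zero)
  let K : Subgroup (absoluteGaloisGroup ℚ) :=
    ⨅ P : W.geomTorsion p, MulAction.stabilizer _ (P : W.geomPoints)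
  have hKopen : IsOpen (K : Set (absoluteGaloisGroup ℚ)) := by
    have : (K : Set (absoluteGaloisGroup ℚ)) =
        ⋂ P : W.geomTorsion p, (MulAction.stabilizer (absoluteGaloisGroup ℚ) (P : W.geomPoints) : Set _) := by
      simp only [K, Subgroup.coe_iInf]
    rw [this]
    exact isOpen_iInter_of_finite fun P : W.geomTorsion p ↦ isOpen_stabilizer_point_holds W (P : W.geomPoints)
  refine ⟨K, hKopen, fun κ hκ ↦ Units.ext ?_⟩
  rw [hφ κ, Units.val_one]
  have hlin : W.galoisRepTorsionLin p κ = LinearMap.id := by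
    refine LinearMap.ext fun P ↦ ?_
    rw [galoisRepTorsionLin_apply, LinearMap.id_apply]
    have hκP : κ ∈ MulAction.stabilizer (absoluteGaloisGroup ℚ) (P : W.geomPoints) :=
      (Subgroup.mem_iInf.mp hκ) P
    rw [MulAction.mem_stabilizer_iff] at hκP
    exact Subtype.ext hκP
  rw [hlin, LinearMap.toMatrix_id]

/-- **The characteristic polynomial of the frame at an arithmetic Frobenius above a good prime `ℓ ≠ p` is
`X² − a_ℓ(W) X + ℓ`** (trace `a_ℓ mod p`, Serre 1981 (238); determinant `ℓ mod p`, DDT Prop. 2.8 (a)).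
[cite: Serre1981, §8.1 eq. (238) (p. 188)] [cite: DarmonDiamondTaylor1995, Prop. 2.8 (a) (PDF p. 56)] -/
theorem charpoly_framed_frobenius_eq [W.IsGloballyMinimal] {ℓ : ℕ} [Fact ℓ.Prime] (hℓp : ℓ ≠ p)
    (hgood : W.HasGoodReductionAtPrime ℓ)
    {v : HeightOneSpectrum (𝓞 ℚ)} (hv : (Rat.HeightOneSpectrum.primesEquiv v : ℕ) = ℓ)
    {𝔓 : Ideal (absIntegers (𝓞 ℚ) ℚ)} (h𝔓 : 𝔓 ∈ v.primesAbove)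
    {Φ : absoluteGaloisGroup ℚ} (hΦ : IsArithFrobAt (𝓞 ℚ) Φ 𝔓) :
    letI : Module (ZMod p) (W.geomTorsion p) := AddSubgroup.torsionBy.zmodModule
    ∀ (b : Module.Basis (Fin 2) (ZMod p) (W.geomTorsion p)) {φ : absoluteGaloisGroup ℚ →* GL (Fin 2) (ZMod p)},
    (∀ σ, ((φ σ : GL (Fin 2) (ZMod p)) : Matrix (Fin 2) (Fin 2) (ZMod p)) =
      LinearMap.toMatrix b b (W.galoisRepTorsionLin p σ)) →
    ((φ Φ : GL (Fin 2) (ZMod p)) : Matrix (Fin 2) (Fin 2) (ZMod p)).charpoly =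
      X ^ 2 - C ((W.frobeniusTrace ℓ : ℤ) : ZMod p) * X + C ((ℓ : ℕ) : ZMod p) := by
  letI : Module (ZMod p) (W.geomTorsion p) := AddSubgroup.torsionBy.zmodModule
  intro b φ hφ
  rw [hφ Φ, Matrix.charpoly_fin_two, ← LinearMap.trace_eq_matrix_trace (ZMod p) b,
    LinearMap.det_toMatrix b]
  have hf : (W.galoisRepTorsion p Φ).toAdd.toAddMonoidHom.toZModLinearMap p = W.galoisRepTorsionLin p Φ :=
    LinearMap.ext fun _ ↦ rfl
  have htr := W.trace_galoisRepTorsion_frobenius_eq p hℓp hgood hv h𝔓 hΦ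
  have hdet := W.det_galoisRepTorsion_frobenius_eq p hℓp hgood hv h𝔓 hΦ
  rw [hf] at htr hdet
  rw [htr, hdet]

end Framed

/-! ## §2b Residues -/

section Residue

variable {S : Type u} [CommRing S] [IsLocalRing S] [TopologicalSpace S] [IsTopologicalRing S]

omit [TopologicalSpace S] [IsTopologicalRing S] in
/-- `residue a = residue b ↔ a − b ∈ 𝔪`. [folklore] -/
theorem residue_eq_residue_iff (a b : S) : residue S a = residue S b ↔ a - b ∈ maximalIdeal S := by
  rw [← sub_eq_zero, ← map_sub, residue_eq_zero_iff]

end Residue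

end Summit.BirchSwinnertonDyer.BirchSwinnertonDyer.Theorems.FibreResidualIdentification

end
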